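import Summits.QuantumFields.YangMills.Theorems.FlatTubeReductionDressedFixedBeta
import Summits.QuantumFields.YangMills.Theorems.FlatTubeReductionDressedColourAverage
import Summits.QuantumFields.YangMills.Theorems.FlatTubeReductionTubeFormNearFarNormalised
import Summits.QuantumFields.YangMills.Theorems.FlatTubeReductionExactDressingTwist
import HarnessLib

/-!
# THE DRESSED (B-T) BRICK AT FIXED `β`: from the symmetric kernel comparison (`…DressedFixedBeta`), the colour average (`…DressedColourAverage`), the pointwise DRESSING EXCHANGE
# `√F(u,u) = √(F(1,1)/2)·(W(u)/n(u))·(1 + O(ε_W))` and the near/far reduction (`…TubeFormNearFarNormalised`) to the `hT`-shaped estimate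
# `|tubeForm β (boFunAd φ (n·Ω₀)) − c·Q_B(φW)| ≤ κ·c·(Q_B(φW) + λ₀(1,B)‖φ‖²)`, `c = F(1,1)/(2·fpZ ε)`, `κ = (κ₀(1+5ε_W)+5ε_W)(1+C_W²) + 2κ₂`
# (route `FlatTubeReduction`, crux K1 `NearFlatRatioLaw` stmt-QuantumFields-24720; seat `ym-line-ftr-p1` g15; rate twin «ratepack-v3 / frozen fibres»; R2b1 RECORD rung — no summit
# statement is proved here)

WHY (memo `Cruxes/NearFlatRatioLaw/Lines/ratepack-v3-frozen-g12.md` §9; NOTES T7b).  `RateTube.AnalyticRatePotInput.hT` compares the BO tube form of the NORMALISED profile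
`Ω_β(u,x) = n_β(u)Ω₀_β(x)` with `σγ·Q_B(φ·W_β)` for the dressed weight `W_β` of the profile package, at relative rate `O(λ_b²)`.  At fixed `β`:
(1) `…DressedFixedBeta.dressed_fixed_beta_estimate`: `|𝔉(u,u') − √F(u)√F(u')K₁(u,u')| ≤ κ₀√F√F'K₁ + τ` on the window (`F(u) = 𝔉(u,u)/K₁(u,u)`, full FP weight at radius `ε`);
(2) `…DressedColourAverage.boKernel_dressed_pointwise_of_fp_add` (`D = √F` is colour invariant by `RateTube.diagRatio_gaugeTransform`): the same for `boKernel` against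
    `(1/Z)·√F√F'·avgKernel`, `Z = fpZ ε`;
(3) the EXCHANGE (`sqrt_dressing_exchange`, `kernel_exchange_pointwise`): on the window `n²m̃ = ½` and `|W² − F/F(1)/m̃| ≤ ε_W`, `|W² − 1| ≤ ½`, `n ≥ 0` give
    `√F(u) = √(F(1)/2)·(W/n)(u)·(1 + r(u))`, `|r| ≤ 2ε_W`, so `(1/Z)√F√F' = c·V(u)V(u')(1 + O(5ε_W))` with `V = W/n` (cut off outside the window), `c = F(1)/(2Z)`;
(4) `RateTube.tubeForm_boFunAd_normalised_near_of_nearFar` with `n·V = W` on the window; (5) `‖φW‖² ≤ C_W²‖φ‖²` and the tail budget `τ ≤ κ₂·btC·λ₀(1,B)` (`btC ≤ F(1,1)`: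
    core weight `≤` full weight, `fpBOKernel_fpWeight_split`) turn the two junk terms into `κ·c·λ₀‖φ‖²`.
* `sqrt_dressing_exchange`, `kernel_exchange_pointwise`, `l2_mul_sq_le` (real-analysis atoms); ★★★ `dressed_hT_fixed_beta`.
HONEST FRAMING: a stub of the CONDITIONAL reduction route R2b1 (rate twin); the schedule facts (smallness, `ε_W ≤ ¼`, the budget `hτ`) are hypotheses here and are discharged
eventually in the schedule files; femto rung R2b1 (RECORD label); not infinite volume, not a gap, not Clay.  No defs, no named facts, no `sorry`.
-/

set_option autoImplicit false

noncomputable section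

open MeasureTheory Filter Topology Real
open scoped BigOperators Matrix Quaternion
open Literature.MathematicalPhysics.QuantumFieldTheory
open Literature.MathematicalPhysics.QuantumLattice

namespace Summit.QuantumFields.YangMills.Theorems.FemtoTransferGap.TwoLattice.ConstTube

open Summit.QuantumFields.YangMills.Theorems.FemtoTransferGap
open Summit.QuantumFields.YangMills.Theorems.FemtoTransferGap.TwoLattice
open Summit.QuantumFields.YangMills.Theorems.FemtoTransferGap.TwoLattice.Avg
open Summit.QuantumFields.YangMills.Theorems.FemtoTransferGap.TwoLattice.Stiff (LinkSpace)
open Summit.QuantumFields.YangMills.Theorems.FemtoTransferGap.TwoLattice.Cov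

variable {L : ℕ} [NeZero L]

/-! ## §1 Real-analysis atoms -/

/-- ★ **The dressing exchange at one point**: if `n²m = ½`, `n > 0`, `W ≥ 0`, `W² ≥ ½`, `a > 0`, `F ≥ 0` and `|W² − F/a/m| ≤ ε`, then `√F = √(a/2)·(W/n)·(1 + r)` with `|r| ≤ 2ε`. [folklore] -/
theorem sqrt_dressing_exchange {F a m n W ε : ℝ} (ha : 0 < a) (hF : 0 ≤ F) (hn : 0 < n) (hnm : n ^ 2 * m = 1 / 2) (hW0 : 0 ≤ W) (hW2 : 1 / 2 ≤ W ^ 2)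
    (hWF : |W ^ 2 - F / a / m| ≤ ε) : ∃ r : ℝ, |r| ≤ 2 * ε ∧ Real.sqrt F = Real.sqrt (a / 2) * (W / n) * (1 + r) := by
  have hWpos : 0 < W := by
    rcases hW0.eq_or_lt with h | h
    · rw [← h] at hW2; norm_num at hW2
    · exact h
  have hm : m = 1 / (2 * n ^ 2) := by field_simp; linarith
  -- `e = W² − F/a/m`, `F = a(W² − e)/(2n²)`
  obtain ⟨e, he⟩ : ∃ e : ℝ, e = W ^ 2 - F / a / m := ⟨_, rfl⟩
  rw [← he] at hWF
  have hFe : F = a / 2 * ((W ^ 2 - e) / n ^ 2) := by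
    rw [he, hm]; field_simp; ring
  have hWe : 0 ≤ W ^ 2 - e := by
    have e2 : W ^ 2 - e = 2 * n ^ 2 * F / a := by rw [hFe]; field_simp
    rw [e2]; positivity
  refine ⟨Real.sqrt (W ^ 2 - e) / W - 1, ?_, ?_⟩
  · -- `|√(W²−e)/W − 1| = |e| / (W(√(W²−e) + W)) ≤ |e|/W² ≤ 2|e|`
    have hs0 : 0 ≤ Real.sqrt (W ^ 2 - e) := Real.sqrt_nonneg _
    have hden : 0 < Real.sqrt (W ^ 2 - e) + W := by linarith
    have e1 : Real.sqrt (W ^ 2 - e) / W - 1 = -e / (W * (Real.sqrt (W ^ 2 - e) + W)) := by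
      have hsq : Real.sqrt (W ^ 2 - e) * Real.sqrt (W ^ 2 - e) = W ^ 2 - e := Real.mul_self_sqrt hWe
      field_simp
      nlinarith [hsq]
    rw [e1, abs_div, abs_neg, abs_of_pos (mul_pos hWpos hden)]
    rw [div_le_iff₀ (mul_pos hWpos hden)]
    have h1 : W ^ 2 ≤ W * (Real.sqrt (W ^ 2 - e) + W) := by nlinarith
    have h2 : |e| ≤ ε := hWF
    have hε0 : 0 ≤ ε := (abs_nonneg _).trans h2
    nlinarith [abs_nonneg e]
  · have hs : Real.sqrt F = Real.sqrt (a / 2) * (Real.sqrt (W ^ 2 - e) / n) := by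
      rw [hFe, Real.sqrt_mul (by positivity), Real.sqrt_div hWe, Real.sqrt_sq hn.le]
    rw [hs]
    field_simp
    ring

/-- ★ **The kernel exchange at one pair**: `(1/Z)·DD' = c·VV'(1+ρ)`, `|ρ| ≤ 5ε`, turns `|b − (1/Z)DD'k| ≤ κ₀(1/Z)DD'k + t` into `|b − cVV'k| ≤ (κ₀(1+5ε) + 5ε)·cVV'k + t`
(`c = a/2/Z`, `D = √(a/2)V(1+r)`, `D' = √(a/2)V'(1+r')`, `|r|,|r'| ≤ 2ε ≤ ½`). [folklore] -/
theorem kernel_exchange_pointwise {b k Z a V V' D D' r r' κ₀ t ε : ℝ} (hk : 0 ≤ k) (hZ : 0 < Z) (ha : 0 ≤ a) (hV : 0 ≤ V) (hV' : 0 ≤ V') (hκ₀ : 0 ≤ κ₀)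
    (hε0 : 0 ≤ ε) (hε : ε ≤ 1 / 4) (hr : |r| ≤ 2 * ε) (hr' : |r'| ≤ 2 * ε)
    (hD : D = Real.sqrt (a / 2) * V * (1 + r)) (hD' : D' = Real.sqrt (a / 2) * V' * (1 + r'))
    (hb : |b - 1 / Z * (D * D') * k| ≤ κ₀ * (1 / Z) * (D * D') * k + t) :
    |b - a / 2 / Z * (V * V') * k| ≤ (κ₀ * (1 + 5 * ε) + 5 * ε) * (a / 2 / Z) * (V * V') * k + t := by
  obtain ⟨P, hP⟩ : ∃ P : ℝ, P = a / 2 / Z * (V * V') * k := ⟨_, rfl⟩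
  have hP0 : 0 ≤ P := by rw [hP]; positivity
  obtain ⟨ρ, hρ⟩ : ∃ ρ : ℝ, ρ = r + r' + r * r' := ⟨_, rfl⟩
  have hρ5 : |ρ| ≤ 5 * ε := by
    rw [hρ]
    have h1 : |r * r'| ≤ 2 * ε * (2 * ε) := by rw [abs_mul]; exact mul_le_mul hr hr' (abs_nonneg _) (by positivity)
    calc |r + r' + r * r'| ≤ |r| + |r'| + |r * r'| := by linarith [abs_add_le (r + r') (r * r'), abs_add_le r r']
      _ ≤ 2 * ε + 2 * ε + 2 * ε * (2 * ε) := by linarith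
      _ ≤ 5 * ε := by nlinarith
  have hDD : 1 / Z * (D * D') * k = P * (1 + ρ) := by
    have hsq : Real.sqrt (a / 2) * Real.sqrt (a / 2) = a / 2 := Real.mul_self_sqrt (by positivity)
    rw [hD, hD', hP, hρ]
    calc 1 / Z * (Real.sqrt (a / 2) * V * (1 + r) * (Real.sqrt (a / 2) * V' * (1 + r'))) * k
        = (Real.sqrt (a / 2) * Real.sqrt (a / 2)) / Z * (V * V') * k * ((1 + r) * (1 + r')) := by ring
      _ = a / 2 / Z * (V * V') * k * (1 + (r + r' + r * r')) := by rw [hsq]; ring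
  have hDD' : κ₀ * (1 / Z) * (D * D') * k = κ₀ * (P * (1 + ρ)) := by
    rw [← hDD]; ring
  rw [hDD, hDD'] at hb
  have hρle := (abs_le.mp hρ5)
  -- `|b − P| ≤ |b − P(1+ρ)| + P|ρ|`
  have h1 : |b - P| ≤ |b - P * (1 + ρ)| + P * |ρ| := by
    have e : b - P = (b - P * (1 + ρ)) + P * ρ := by ring
    rw [e]
    exact (abs_add_le _ _).trans (by rw [abs_mul, abs_of_nonneg hP0])
  have h2 : P * |ρ| ≤ P * (5 * ε) := mul_le_mul_of_nonneg_left hρ5 hP0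
  have h3 : κ₀ * (P * (1 + ρ)) ≤ κ₀ * (P * (1 + 5 * ε)) := mul_le_mul_of_nonneg_left (mul_le_mul_of_nonneg_left (by linarith [hρle.2]) hP0) hκ₀
  have e4 : (κ₀ * (1 + 5 * ε) + 5 * ε) * (a / 2 / Z) * (V * V') * k = κ₀ * (P * (1 + 5 * ε)) + P * (5 * ε) := by rw [hP]; ring
  rw [e4, ← hP]
  linarith [h1, h2, h3, hb]

/-- `‖φW‖² ≤ C_W²‖φ‖²` for `|W| ≤ C_W` (bounded measurable `φ`). [folklore] -/
theorem l2_mul_sq_le {M : ℕ} [NeZero M] {φ W : GaugeConfig 3 M SU2 → ℝ} (hφm : Measurable φ) {Cφ : ℝ} (hCφ : ∀ u, |φ u| ≤ Cφ) (hWm : Measurable W) {CW : ℝ}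
    (hCW : ∀ u, |W u| ≤ CW) : l2 (fun u => φ u * W u) (fun u => φ u * W u) ≤ CW ^ 2 * l2 φ φ := by
  rw [l2_self_eq_integral_sq, l2_self_eq_integral_sq, ← integral_const_mul]
  have hCφ0 : 0 ≤ Cφ := (abs_nonneg _).trans (hCφ 1)
  have hCW0 : 0 ≤ CW := (abs_nonneg _).trans (hCW 1)
  refine integral_mono ?_ ?_ fun u => ?_
  · exact integrable_of_measurable_abs_le _ ((hφm.mul hWm).pow_const 2) (C := (Cφ * CW) ^ 2) fun u => by
      rw [abs_pow, mul_pow, abs_mul, mul_pow]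
      exact mul_le_mul (pow_le_pow_left₀ (abs_nonneg _) (hCφ u) 2) (pow_le_pow_left₀ (abs_nonneg _) (hCW u) 2) (by positivity) (by positivity)
  · exact (integrable_of_measurable_abs_le _ (hφm.pow_const 2) (C := Cφ ^ 2) fun u => by
      rw [abs_pow]; exact pow_le_pow_left₀ (abs_nonneg _) (hCφ u) 2).const_mul _
  · show (φ u * W u) ^ 2 ≤ CW ^ 2 * φ u ^ 2
    rw [mul_pow]
    have h := pow_le_pow_left₀ (abs_nonneg _) (hCW u) 2
    rw [sq_abs] at h
    nlinarith [sq_nonneg (φ u), h]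

/-! ## §2 ★★★ The dressed (B-T) brick at fixed `β` -/

set_option maxHeartbeats 1600000 in
/-- ★★★ **THE DRESSED (B-T) BRICK AT FIXED `β`** (see the module docstring): under the smallness hypotheses of `dressed_fixed_beta_estimate`, the window facts of the profile/dressing
package at this `β` (`n` measurable, `0 ≤ n ≤ 1`, gauge invariant; `W` physical, `0 ≤ W ≤ C_W`; on the window `|W² − F/F(1)/m̃| ≤ ε_W ≤ ¼`, `n²m̃ = ½`, `|W² − 1| ≤ ½`, `|m̃ − 1| ≤ ½`),
`𝔉(1,1) > 0` and the tail budget `τ ≤ κ₂·btC·λ₀(1,L³β)`: for every bounded measurable gauge-invariant `φ` supported in the window,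
`|tubeForm β (boFunAd φ (n·Ω)) − c·Q(φW)| ≤ ((κ₀(1+5ε_W)+5ε_W)(1+C_W²) + 2κ₂)·c·(Q(φW) + λ₀‖φ‖²)`, `c = F(1,1)/2/fpZ ε`. [cite: Luscher1983, §3] -/
theorem dressed_hT_fixed_beta {β : ℝ} (hβ : 0 ≤ β) {Ω : LinkSpace L → ℝ} (hΩm : Measurable Ω) (hΩ1 : ∀ x, |Ω x| ≤ 1) (hΩ0 : ∀ x, 0 ≤ Ω x)
    (hΩinv : ∀ (g : SU2) (x : LinkSpace L), Ω (adL L g x) = Ω x) {δ α t R R₁ ε P₀ : ℝ}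
    (hΩt : ∀ v : Edge 3 L → Fin 3 → ℝ, Ω (linkEmbed L v) ≠ 0 → v ∈ capBalancedSet L ∧ (∀ (e : Edge 3 L) (c : Fin 3), |v e c| ≤ t) ∧ ‖linkEmbed L v‖ ≤ R)
    (hδ2 : δ ≤ 1 / 2) (hα0 : 0 ≤ α) (hα1 : α ≤ 1) (hε0 : 0 < ε) (ht0 : 0 ≤ t)
    (htT : t ≤ 9 * L * R₁ + ε) (hT : 9 * L * R₁ + ε ≤ 1 / 30) (hσ : (L : ℝ) ^ 3 * (12 * δ ^ 4) < 2)
    (hεsum : coreEps1 L β δ (9 * L * R₁ + ε) R + coreEps2 L β δ (9 * L * R₁ + ε) R ((L : ℝ) ^ 3 * (12 * δ ^ 4)) ≤ 1)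
    (hηd : coreEta L β δ α (9 * L * R₁ + ε) R (ε * Fintype.card (Site 3 L)) ((L : ℝ) ^ 3 * (12 * δ ^ 4)) ≤ 1)
    (hηs : β * ((Fintype.card (Edge 3 L) : ℝ) * (558 * α ^ 2 * (9 * L * R₁ + ε) ^ 2 + 192 * α * (9 * L * R₁ + ε) ^ 2) + 216 * α * δ * (ε * Fintype.card (Site 3 L))) +
        β / 2 * (100 * ((L : ℝ) ^ 3 * (12 * δ ^ 4)) * (Fintype.card (Plaquette 3 L × Fin 3) : ℝ) * R ^ 2 + 2 * stepActionErr (L := L) t ((L : ℝ) ^ 3 * (12 * δ ^ 4)) +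
          10080 * α * (Fintype.card (Plaquette 3 L × Fin 3) : ℝ) * R ^ 2) ≤ 1)
    (hLa : 18 * L * (Real.sqrt 2 * R + δ) ≤ 1 / 2)
    (hm₁ : 0 ≤ R₁ / 2 - 2 * (Real.sqrt 2 * R + δ) * ε - (2 * Real.sqrt 2 * R + α)) (hm₂ : 0 ≤ 1 / (3 * L) - 4 * (Real.sqrt 2 * R + δ) - (2 * Real.sqrt 2 * R + α))
    (hP : 3 * L * P₀ < 1) (hP0 : 0 ≤ P₀ - 4 * (Real.sqrt 2 * R + δ) - (2 * Real.sqrt 2 * R + 2 * δ))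
    (hJ : 2 * ε * Fintype.card (Site 3 L) * δ + 2 * R ^ 2 + 2 * Real.sqrt 2 * Fintype.card (Site 3 L) * (9 * L * P₀ + ε) * R ≤ Fintype.card (Site 3 L) * (1 - 3 * L * P₀) * α)
    -- the normaliser and the dressing at this `β`
    {n W m : GaugeConfig 3 1 SU2 → ℝ} (hnm : Measurable n) (hn01 : ∀ u, 0 ≤ n u ∧ n u ≤ 1)
    (hng : ∀ (g : Site 3 1 → SU2) (u : GaugeConfig 3 1 SU2), n (gaugeTransform g u) = n u)
    (hWphys : IsPhys W) (hW0 : ∀ u, 0 ≤ W u) {CW : ℝ} (hWC : ∀ u, |W u| ≤ CW) {εW : ℝ} (hεW0 : 0 ≤ εW) (hεW4 : εW ≤ 1 / 4)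
    (hwin : ∀ u : GaugeConfig 3 1 SU2, orbitDist u < δ →
      |W u ^ 2 - fpBOKernel L β Ω (fpWeight L ε) u u / transferKernel su2Rep ((L : ℝ) ^ 3 * β) u u /
          (fpBOKernel L β Ω (fpWeight L ε) 1 1 / transferKernel su2Rep ((L : ℝ) ^ 3 * β) (1 : GaugeConfig 3 1 SU2) 1) / m u| ≤ εW ∧
        n u ^ 2 * m u = 1 / 2 ∧ |W u ^ 2 - 1| ≤ 1 / 2 ∧ |m u - 1| ≤ 1 / 2)
    (ha0 : 0 < fpBOKernel L β Ω (fpWeight L ε) 1 1) {κ₂ : ℝ} (hκ₂ : 0 ≤ κ₂)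
    (hτ : Real.exp (6 * ((L : ℝ) ^ 3 * β)) *
        (Real.exp (3 * ((L : ℝ) ^ 3 * β) * α ^ 2) * (Real.exp (-(β * btMnt L δ α R R₁ ε) + β * stepActionErr (L := L) t ((L : ℝ) ^ 3 * (12 * δ ^ 4))) *
              (∫ v, Ω (linkEmbed L v) ∂orthoTransverse L) ^ 2) +
          2 * Real.sqrt (Real.exp (-(β * btMnt L δ α R R₁ ε) + β * stepActionErr (L := L) t ((L : ℝ) ^ 3 * (12 * δ ^ 4))) * (∫ v, Ω (linkEmbed L v) ∂orthoTransverse L) ^ 2) *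
            Real.sqrt (9 * btC L β Ω ε R₁ + Real.exp (-(β * btMnt L δ α R R₁ ε) + β * stepActionErr (L := L) t ((L : ℝ) ^ 3 * (12 * δ ^ 4))) * (∫ v, Ω (linkEmbed L v) ∂orthoTransverse L) ^ 2) +
          Real.exp (-(β * btMfar L δ α R ε P₀)) * (∫ v, Ω (linkEmbed L v) ∂orthoTransverse L) ^ 2 +
          (9 * btC L β Ω ε R₁ + Real.exp (-(β * btMnt L δ α R R₁ ε) + β * stepActionErr (L := L) t ((L : ℝ) ^ 3 * (12 * δ ^ 4))) * (∫ v, Ω (linkEmbed L v) ∂orthoTransverse L) ^ 2) *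
            Real.exp (-((L : ℝ) ^ 3 * β * α ^ 2))) ≤
      κ₂ * btC L β Ω ε R₁ * levelValue su2Rep 1 ((L : ℝ) ^ 3 * β) 0)
    (φ : GaugeConfig 3 1 SU2 → ℝ) (hφm : Measurable φ) {Cφ : ℝ} (hCφ : ∀ u, |φ u| ≤ Cφ)
    (hφg : ∀ (g : Site 3 1 → SU2) (u : GaugeConfig 3 1 SU2), φ (gaugeTransform g u) = φ u) (hsupp : ∀ u, φ u ≠ 0 → orbitDist u < δ) :
    |tubeForm β (RateTube.boFunAd L φ (fun u x => n u * Ω x)) -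
        fpBOKernel L β Ω (fpWeight L ε) 1 1 / transferKernel su2Rep ((L : ℝ) ^ 3 * β) (1 : GaugeConfig 3 1 SU2) 1 / 2 / fpZ ε *
          qform su2Rep ((L : ℝ) ^ 3 * β) (fun u => φ u * W u) (fun u => φ u * W u)| ≤
      (((β * (Fintype.card (Edge 3 L) : ℝ) * α ^ 2 * (6 * t + 2 * (9 * L * R₁ + ε)) ^ 2 +
          120 * (β * ((Fintype.card (Edge 3 L) : ℝ) * (558 * α ^ 2 * (9 * L * R₁ + ε) ^ 2 + 192 * α * (9 * L * R₁ + ε) ^ 2) + 216 * α * δ * (ε * Fintype.card (Site 3 L))) +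
            β / 2 * (100 * ((L : ℝ) ^ 3 * (12 * δ ^ 4)) * (Fintype.card (Plaquette 3 L × Fin 3) : ℝ) * R ^ 2 + 2 * stepActionErr (L := L) t ((L : ℝ) ^ 3 * (12 * δ ^ 4)) +
              10080 * α * (Fintype.card (Plaquette 3 L × Fin 3) : ℝ) * R ^ 2)) ^ 2) * (1 + 5 * εW) + 5 * εW) * (1 + CW ^ 2) + 2 * κ₂) *
        (fpBOKernel L β Ω (fpWeight L ε) 1 1 / transferKernel su2Rep ((L : ℝ) ^ 3 * β) (1 : GaugeConfig 3 1 SU2) 1 / 2 / fpZ ε) *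
        (qform su2Rep ((L : ℝ) ^ 3 * β) (fun u => φ u * W u) (fun u => φ u * W u) + levelValue su2Rep 1 ((L : ℝ) ^ 3 * β) 0 * l2 φ φ) := by
  have hB0 : (0 : ℝ) ≤ (L : ℝ) ^ 3 * β := by positivity
  have hZ0 : 0 < fpZ ε := fpZ_pos hε0
  have hCW0 : 0 ≤ CW := (abs_nonneg _).trans (hWC 1)
  have hCφ0 : 0 ≤ Cφ := (abs_nonneg _).trans (hCφ 1)
  have hWm : Measurable W := hWphys.measurable
  have hfw := measurable_fpWeight L ε
  have hfw1 := abs_fpWeight_le L ε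
  have hF0 : ∀ u : GaugeConfig 3 1 SU2, 0 ≤ fpBOKernel L β Ω (fpWeight L ε) u u / transferKernel su2Rep ((L : ℝ) ^ 3 * β) u u := fun u =>
    div_nonneg (fpBOKernel_nonneg β hΩm hΩ1 hΩ0 hfw hfw1 (fun g => (fpWeight_mem_Icc L ε g).1) u u) (transferKernel_pos _ _ _ _).le
  -- opaque names: `a = F(1,1)`, `κ₀`, `τ`
  obtain ⟨a, ha⟩ : ∃ a : ℝ, a = fpBOKernel L β Ω (fpWeight L ε) 1 1 / transferKernel su2Rep ((L : ℝ) ^ 3 * β) (1 : GaugeConfig 3 1 SU2) 1 := ⟨_, rfl⟩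
  have ha_pos : 0 < a := by rw [ha]; exact div_pos ha0 (transferKernel_pos _ _ _ _)
  rw [← ha] at hwin ⊢
  obtain ⟨κ₀, hκ₀def⟩ : ∃ κ₀ : ℝ, κ₀ = β * (Fintype.card (Edge 3 L) : ℝ) * α ^ 2 * (6 * t + 2 * (9 * L * R₁ + ε)) ^ 2 +
          120 * (β * ((Fintype.card (Edge 3 L) : ℝ) * (558 * α ^ 2 * (9 * L * R₁ + ε) ^ 2 + 192 * α * (9 * L * R₁ + ε) ^ 2) + 216 * α * δ * (ε * Fintype.card (Site 3 L))) +
            β / 2 * (100 * ((L : ℝ) ^ 3 * (12 * δ ^ 4)) * (Fintype.card (Plaquette 3 L × Fin 3) : ℝ) * R ^ 2 + 2 * stepActionErr (L := L) t ((L : ℝ) ^ 3 * (12 * δ ^ 4)) +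
              10080 * α * (Fintype.card (Plaquette 3 L × Fin 3) : ℝ) * R ^ 2)) ^ 2 := ⟨_, rfl⟩
  rw [← hκ₀def]
  have hκ₀0 : 0 ≤ κ₀ := by rw [hκ₀def]; positivity
  have hC0 : 0 ≤ btC L β Ω ε R₁ := by
    unfold btC
    exact div_nonneg (fpBOKernel_nonneg β hΩm hΩ1 hΩ0 (measurable_coreWeight ε R₁) (abs_coreWeight_le ε R₁) (fun g => (coreWeight_mem_Icc ε R₁ g).1) 1 1)
      (transferKernel_pos _ _ _ _).le
  obtain ⟨τ, hτdef⟩ : ∃ τ : ℝ, τ = Real.exp (6 * ((L : ℝ) ^ 3 * β)) *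
        (Real.exp (3 * ((L : ℝ) ^ 3 * β) * α ^ 2) * (Real.exp (-(β * btMnt L δ α R R₁ ε) + β * stepActionErr (L := L) t ((L : ℝ) ^ 3 * (12 * δ ^ 4))) *
              (∫ v, Ω (linkEmbed L v) ∂orthoTransverse L) ^ 2) +
          2 * Real.sqrt (Real.exp (-(β * btMnt L δ α R R₁ ε) + β * stepActionErr (L := L) t ((L : ℝ) ^ 3 * (12 * δ ^ 4))) * (∫ v, Ω (linkEmbed L v) ∂orthoTransverse L) ^ 2) *
            Real.sqrt (9 * btC L β Ω ε R₁ + Real.exp (-(β * btMnt L δ α R R₁ ε) + β * stepActionErr (L := L) t ((L : ℝ) ^ 3 * (12 * δ ^ 4))) * (∫ v, Ω (linkEmbed L v) ∂orthoTransverse L) ^ 2) +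
          Real.exp (-(β * btMfar L δ α R ε P₀)) * (∫ v, Ω (linkEmbed L v) ∂orthoTransverse L) ^ 2 +
          (9 * btC L β Ω ε R₁ + Real.exp (-(β * btMnt L δ α R R₁ ε) + β * stepActionErr (L := L) t ((L : ℝ) ^ 3 * (12 * δ ^ 4))) * (∫ v, Ω (linkEmbed L v) ∂orthoTransverse L) ^ 2) *
            Real.exp (-((L : ℝ) ^ 3 * β * α ^ 2))) := ⟨_, rfl⟩
  rw [← hτdef] at hτ
  have hτ0 : 0 ≤ τ := by rw [hτdef]; positivity
  -- `btC ≤ a` (core weight ≤ full weight) and the budget in the form `τ/Z ≤ κ₂·a·λ₀/Z`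
  have hlam0 : 0 ≤ levelValue su2Rep 1 ((L : ℝ) ^ 3 * β) 0 := levelValue_su2Rep_nonneg 1 hB0 0
  have hCa : btC L β Ω ε R₁ ≤ a := by
    rw [ha]; unfold btC
    refine div_le_div_of_nonneg_right ?_ (transferKernel_pos _ _ _ _).le
    rw [fpBOKernel_fpWeight_split β ε R₁ hΩm hΩ1 1 1]
    have := fpBOKernel_nonneg β hΩm hΩ1 hΩ0 (measurable_tailWeight ε R₁) (abs_tailWeight_le ε R₁) (fun g => (tailWeight_mem_Icc ε R₁ g).1)
      (1 : GaugeConfig 3 1 SU2) 1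
    linarith
  have hθ : τ / fpZ ε ≤ κ₂ * a * levelValue su2Rep 1 ((L : ℝ) ^ 3 * β) 0 / fpZ ε := by
    refine div_le_div_of_nonneg_right (hτ.trans ?_) hZ0.le
    exact mul_le_mul_of_nonneg_right (mul_le_mul_of_nonneg_left hCa hκ₂) hlam0
  -- the dressing `D = √F`
  obtain ⟨D, hD⟩ : ∃ D : GaugeConfig 3 1 SU2 → ℝ, D = fun u => Real.sqrt (fpBOKernel L β Ω (fpWeight L ε) u u / transferKernel su2Rep ((L : ℝ) ^ 3 * β) u u) := ⟨_, rfl⟩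
  have hDu : ∀ u, D u = Real.sqrt (fpBOKernel L β Ω (fpWeight L ε) u u / transferKernel su2Rep ((L : ℝ) ^ 3 * β) u u) := fun u => by rw [hD]
  have hDinv : ∀ (c : SU2) (u : GaugeConfig 3 1 SU2), D (gaugeTransform (fun _ : Site 3 1 => c) u) = D u := fun c u => by
    rw [hDu, hDu, RateTube.diagRatio_gaugeTransform β hΩm hΩinv hfw (fun c g => fpWeight_conj _ c g) (fun _ : Site 3 1 => c) u]
  -- (1) the symmetric comparison of `…DressedFixedBeta`
  have hpt1 : ∀ w u' : GaugeConfig 3 1 SU2, orbitDist w < δ → orbitDist u' < δ →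
      |fpBOKernel L β Ω (fpWeight L ε) w u' - 1 * (D w * D u') * transferKernel su2Rep ((L : ℝ) ^ 3 * β) w u'| ≤ κ₀ * 1 * (D w * D u') * transferKernel su2Rep ((L : ℝ) ^ 3 * β) w u' + τ := by
    intro w u' hw hu'
    have h := dressed_fixed_beta_estimate hβ hΩm hΩ1 hΩ0 hΩinv hΩt hδ2 hα0 hα1 hε0.le ht0 htT hT hσ hεsum hηd hηs hLa hm₁ hm₂ hP hP0 hJ w u' hw hu'
    rw [← hκ₀def, ← hτdef] at h
    rw [hDu w, hDu u', one_mul, mul_one]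
    calc _ ≤ _ := h
      _ = _ := by ring
  -- (2) the colour average
  have hdoor : ∀ u u' : GaugeConfig 3 1 SU2, orbitDist u < δ → orbitDist u' < δ →
      |boKernel L β Ω u u' - 1 / fpZ ε * (D u * D u') * avgKernel ((L : ℝ) ^ 3 * β) u u'| ≤
        κ₀ * (1 / fpZ ε) * (D u * D u') * avgKernel ((L : ℝ) ^ 3 * β) u u' + τ / fpZ ε :=
    fun u u' hu hu' => boKernel_dressed_pointwise_of_fp_add β ((L : ℝ) ^ 3 * β) hΩm hΩ1 hΩinv hfw hfw1 hZ0 (fpWeight_orbit L ε) hDinv hpt1 u u' hu hu'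
  -- (3) the cut-off quotient `V = W/n` on the window and the exchange
  obtain ⟨V, hV⟩ : ∃ V : GaugeConfig 3 1 SU2 → ℝ, V = fun u => if orbitDist u < δ then W u / n u else 0 := ⟨_, rfl⟩
  have hVu : ∀ u, V u = if orbitDist u < δ then W u / n u else 0 := fun u => by rw [hV]
  have hVm : Measurable V := by
    rw [hV]; exact Measurable.ite (measurableSet_lt measurable_orbitDist measurable_const) (hWm.div hnm) measurable_const
  have hwin' : ∀ u, orbitDist u < δ → 0 < n u ∧ V u = W u / n u ∧ 0 ≤ V u ∧ V u ≤ 2 * CW := by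
    intro u hu
    obtain ⟨-, hnmu, -, hm1⟩ := hwin u hu
    obtain ⟨hn0, -⟩ := hn01 u
    have hn_ne : n u ≠ 0 := fun h => by rw [h] at hnmu; norm_num at hnmu
    have hnpos : 0 < n u := lt_of_le_of_ne hn0 (Ne.symm hn_ne)
    have hm32 : m u ≤ 3 / 2 := by have := (abs_le.mp hm1).2; linarith
    have hn2 : (1 / 2 : ℝ) ^ 2 ≤ n u ^ 2 := by
      have := mul_le_mul_of_nonneg_left hm32 (sq_nonneg (n u)); nlinarith only [this, hnmu]
    have hnhalf : 1 / 2 ≤ n u := (pow_le_pow_iff_left₀ (by norm_num) hn0 two_ne_zero).mp hn2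
    have hVe : V u = W u / n u := by rw [hVu, if_pos hu]
    have hWle : W u ≤ CW := (le_abs_self _).trans (hWC u)
    refine ⟨hnpos, hVe, by rw [hVe]; exact div_nonneg (hW0 u) hn0, ?_⟩
    rw [hVe, div_le_iff₀ hnpos]
    have := mul_le_mul_of_nonneg_left hnhalf (by positivity : (0 : ℝ) ≤ 2 * CW)
    linarith
  have hCV : ∀ u, |V u| ≤ 2 * CW := fun u => by
    by_cases hu : orbitDist u < δ
    · obtain ⟨-, -, h0, h2⟩ := hwin' u hu; rw [abs_of_nonneg h0]; exact h2
    · rw [hVu, if_neg hu, abs_zero]; positivity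
  have hVg : ∀ (g : Site 3 1 → SU2) (u : GaugeConfig 3 1 SU2), V (gaugeTransform g u) = V u := fun g u => by
    rw [hVu, hVu, orbitDist_gaugeTransform, hWphys.gaugeInv, hng]
  have hnV : ∀ u, orbitDist u < δ → n u * V u = W u := fun u hu => by
    obtain ⟨hn, hVe, -, -⟩ := hwin' u hu; rw [hVe]; field_simp
  have hpt2 : ∀ u u' : GaugeConfig 3 1 SU2, orbitDist u < δ → orbitDist u' < δ →
      |boKernel L β Ω u u' - a / 2 / fpZ ε * (V u * V u') * avgKernel ((L : ℝ) ^ 3 * β) u u'| ≤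
        (κ₀ * (1 + 5 * εW) + 5 * εW) * (a / 2 / fpZ ε) * (|V u| * |V u'|) * avgKernel ((L : ℝ) ^ 3 * β) u u' + τ / fpZ ε := by
    intro u u' hu hu'
    obtain ⟨hnu, hVe, hV0, -⟩ := hwin' u hu
    obtain ⟨hnu', hVe', hV0', -⟩ := hwin' u' hu'
    obtain ⟨hWu, hnmu, hW1u, -⟩ := hwin u hu
    obtain ⟨hWu', hnmu', hW1u', -⟩ := hwin u' hu'
    have hW2u : 1 / 2 ≤ W u ^ 2 := by have := (abs_le.mp hW1u).1; linarith
    have hW2u' : 1 / 2 ≤ W u' ^ 2 := by have := (abs_le.mp hW1u').1; linarith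
    obtain ⟨r, hr, hDr⟩ := sqrt_dressing_exchange ha_pos (hF0 u) hnu hnmu (hW0 u) hW2u hWu
    obtain ⟨r', hr', hDr'⟩ := sqrt_dressing_exchange ha_pos (hF0 u') hnu' hnmu' (hW0 u') hW2u' hWu'
    have hD1 : D u = Real.sqrt (a / 2) * V u * (1 + r) := by rw [hDu, hDr, hVe]
    have hD2 : D u' = Real.sqrt (a / 2) * V u' * (1 + r') := by rw [hDu, hDr', hVe']
    have h := kernel_exchange_pointwise (avgKernel_pos _ u u').le hZ0 ha_pos.le hV0 hV0' hκ₀0 hεW0 hεW4 hr hr' hD1 hD2 (hdoor u u' hu hu')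
    rw [abs_of_nonneg hV0, abs_of_nonneg hV0']; exact h
  -- (4) the near/far reduction with the normaliser
  have hc0 : 0 ≤ a / 2 / fpZ ε := by positivity
  have hκ₁0 : 0 ≤ κ₀ * (1 + 5 * εW) + 5 * εW := by positivity
  have hθ0 : 0 ≤ τ / fpZ ε := by positivity
  have hδ' : δ < 2 := by linarith
  have hn1 : ∀ u, |n u| ≤ 1 := fun u => by obtain ⟨h0, h1⟩ := hn01 u; rw [abs_of_nonneg h0]; exact h1
  have hmain := RateTube.tubeForm_boFunAd_normalised_near_of_nearFar β hB0 hΩm hΩ1 hc0 hκ₁0 hθ0 hδ' hnm hn1 hng hVm hCV hVg hnV hpt2 hφm hCφ hφg hsupp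
  -- (5) bookkeeping: `‖φW‖² ≤ C_W²‖φ‖²`, the budget, nonnegativity
  have hlW := l2_mul_sq_le hφm hCφ hWm hWC
  have hq0 : 0 ≤ qform su2Rep ((L : ℝ) ^ 3 * β) (fun u => φ u * W u) (fun u => φ u * W u) :=
    qform_self_nonneg_of_bounded hB0 (hφm.mul hWm) (C := Cφ * CW) fun u => by rw [abs_mul]; exact mul_le_mul (hCφ u) (hWC u) (abs_nonneg _) hCφ0
  have hl0 : 0 ≤ l2 φ φ := l2_self_nonneg φ
  obtain ⟨q, hq⟩ : ∃ q : ℝ, q = qform su2Rep ((L : ℝ) ^ 3 * β) (fun u => φ u * W u) (fun u => φ u * W u) := ⟨_, rfl⟩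
  obtain ⟨lam, hlam⟩ : ∃ lam : ℝ, lam = levelValue su2Rep 1 ((L : ℝ) ^ 3 * β) 0 := ⟨_, rfl⟩
  obtain ⟨c, hc⟩ : ∃ c : ℝ, c = a / 2 / fpZ ε := ⟨_, rfl⟩
  rw [← hq, ← hlam, ← hc] at hmain ⊢
  rw [← hq] at hq0
  rw [← hlam] at hlam0 hθ
  rw [← hc] at hc0
  have p1 : lam * l2 (fun u => φ u * W u) (fun u => φ u * W u) ≤ lam * (CW ^ 2 * l2 φ φ) := mul_le_mul_of_nonneg_left hlW hlam0
  have p2 : (κ₀ * (1 + 5 * εW) + 5 * εW) * c * (q + lam * l2 (fun u => φ u * W u) (fun u => φ u * W u)) ≤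
      (κ₀ * (1 + 5 * εW) + 5 * εW) * c * (q + lam * (CW ^ 2 * l2 φ φ)) := mul_le_mul_of_nonneg_left (by linarith) (mul_nonneg hκ₁0 hc0)
  have p3 : τ / fpZ ε * l2 φ φ ≤ (κ₂ * a * lam / fpZ ε) * l2 φ φ := mul_le_mul_of_nonneg_right hθ hl0
  have e3 : κ₂ * a * lam / fpZ ε = 2 * κ₂ * c * lam := by rw [hc]; field_simp
  rw [e3] at p3
  have n1 : 0 ≤ (κ₀ * (1 + 5 * εW) + 5 * εW) * CW ^ 2 * (c * q) := by positivity
  have n2 : 0 ≤ κ₂ * (c * q) := by positivity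
  have n3 : 0 ≤ (κ₀ * (1 + 5 * εW) + 5 * εW) * (c * (lam * l2 φ φ)) := by positivity
  linarith [hmain, p2, p3, n1, n2, n3]

end Summit.QuantumFields.YangMills.Theorems.FemtoTransferGap.TwoLattice.ConstTube

end
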